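import Summits.HodgeConjecture.HodgeConjecture.Theorems.F0P3cStCharTSWeylHypTubeReduction     -- ★ p851817 (this seat) (J1) FILE 2 «COSET REDUCTION» `tubeJacobianLocal_of_cover`; brings ★ p851761 FILE 1 `exists_radialMeasure_tube`, `exists_isOpen_regular_wfree_nhds`, ★ p851645
import Summits.HodgeConjecture.HodgeConjecture.Theorems.F0P3cStCharTSQuotientMassOpenSubgroup  -- ★ p851706 (LH6-p03 g5) (J6a) `quotientMeasure_image_mul_measure_eq` (`μ₀(π K)·tm(T ∩ K) = ν(K)` for open subgroups)
import Summits.HodgeConjecture.HodgeConjecture.Theorems.F0P3cStCharTSOpenCosetCover          -- ★ p851804 (F0P3-p02 g21) (J6b) `cosetFamily_measurable_and_cover` (disjoint coset covers of open sets)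
import HarnessLib

/-!
# F0 · P3c · line LH6 «StCharTS» — ROAD «JAC-LOC» brick (J6) «ASSEMBLY → hJacLoc», FILE 1: the local tube-Jacobian socket of ★ p851645 from the
# ORBIT-TUBE identity `Ad(K_n)(s·T_n) = s·P` and the measure identity `ν(P) = D(s)·ν(K_n)` on a level basis `K_n` (Harish-Chandra 1970 L. 22; Rogawski 1990 §12.5 p. 182)

Cell `pub/hodgecm-mathlib`, crux H413 = `stmt-HodgeConjecture-24833` (lane `--supports`, helper); seat LH6-p04 (g6); brick (J6) of LH6-p03 (g5)'s ROAD «JAC-LOC»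
(dealt 2026-09-02T15:10:53Z; memo `F0/P3b/LH6-p03/g5/ROAD-JAC-LOC.v3.LH6p03g5.md` §5–§6).  THEOREMS ONLY; sorry-free; no definition ∕ instance ∕ notation; axioms TRIO.
HONEST LABEL: count-neutral, closes no organ; HC_CM is proved only modulo the 7 printed citations (2 remaining: hLiu418 = `stmt-HodgeConjecture-24832`, h413 =
`stmt-HodgeConjecture-24833`) until rung 0 closes.  (The road pays the HYPERBOLIC half of the print residue «WIF» of the (S-𝔇) organ `stub_EllipticPackage`.)

WHAT.  `G = U(Φ₃)(L⁺_v)` (CM carrier, `v` non-split), `T = (cmBorelTriple L 3 v).M` the split torus, `ν` Haar on `G`, `tm` on `T`, `μ₀` the quotient measure on `G ⧸ T`,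
`Φ(q, t) = x t x⁻¹`, `w` the Weyl element, `D : T → ℝ≥0` any weight.  INPUTS (the shapes the road's bricks deliver, on the CM carrier; binders of ★ p851645 VERBATIM):
* a LEVEL BASIS `K : ℕ → Subgroup G` — compact open subgroups, antitone, a neighbourhood basis of `1` ((J2) levels `K_γ` pulled back along ★ `localNonsplitEquiv`,
  indexed by a schedule (J5-ARITH));
* `horbit` — at every regular `t₀`: an open `U ∋ t₀` on which `D` is CONSTANT (SHIFT-LC: the root-unit sizes `|a−1|, |b−1|, …` are locally constant) and a threshold
  `n₀` such that for every `n ≥ n₀` and every level coset `C = s·T_n ⊆ U` (`T_n = T ∩ K_n`) there is a measurable `P ⊆ G` with the ORBIT-TUBE identity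
  `{k (s τ) k⁻¹ : k ∈ K_n, τ ∈ T_n} = s·P` ((J4c) `⊆` ★ p851809 + (J5c) `⊇`, `P = P̃ = N̄[..]·T_n·N[..]·K_ε`) and the MEASURE identity `ν(P) = D(s)·ν(K_n)` ((J4b) over ★ (J4a)
  `measure_sandwich_eq`, ★ (J2) `measure_vanDijk_box`, (J7) `D = DG²`).
OUTPUT: **`tubeJacobianLocal_of_orbitTube`** — the `hJacLoc` clause of ★ `F0P3cStCharTSWeylHypJacobianLocal.lintegral_hypSet_eq_of_tubeJacobian_local` VERBATIM (so ★ p851645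
gives «radial measure `= D · tm` on `T^{reg}`», and ★ p849989's port the (WIF) density on `Ω`, unconditionally once the inputs are ★).
PROOF (memo §2 (J6)): ★ (J1) FILE 1 `exists_radialMeasure_tube` gives the radial `σ` with `ν(Φ(A × V)) = μ₀(A)·σ(V)` for every measurable `A` and every measurable
regular `W`-free `V`; for a coset `C = s·T_n` inside `U ∩` (the `W`-free regular neighbourhood ★ `exists_isOpen_regular_wfree_nhds`): `Φ(π(K_n) × C) = Ad(K_n)(sT_n) = s·P`, so
`μ₀(π K_n)·σ(C) = ν(s·P) = ν(P) = D(s)·ν(K_n) = D(s)·μ₀(π K_n)·tm(T_n)` (★ (J6a)), i.e. `σ(C) = D(s)·tm(T_n) = D(s)·tm(C) = ∫⁻_C D dtm` (`D ≡ D(s)` on `C ⊆ U`); then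
★ (J1) FILE 2 `tubeJacobianLocal_of_cover` with `A₀ = π(K_{n₀})` and the disjoint coset covers of ★ (J6b) `cosetFamily_measurable_and_cover` (the `T_n` are open in `T`,
antitone, a basis of `𝓝 1`).  FILE 2 of (J6) (ED. 2, when (J4b)(J5c)(J5-ARITH)(SHIFT-LC)(J7) are ★) instantiates `K`, `P`, `D = DG²` and discharges `horbit`.

## References
* [HarishChandra1970] Harish-Chandra, *Harmonic analysis on reductive p-adic groups*, LNM 162 (1970), Lemma 22 (Jacobian of conjugation), Lemma 42.
* [Rogawski1990] J. D. Rogawski, *Automorphic Representations of Unitary Groups in Three Variables*, Ann. of Math. Stud. 123 (1990), §12.5 p. 182.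
* [vanDijk1972] G. van Dijk, *Computation of certain induced characters of p-adic groups*, Math. Ann. 199 (1972) 229–240, §2.
* [Folland1995] G. B. Folland, *A Course in Abstract Harmonic Analysis* (1995), §2.6 Thm. 2.49 (quotient integral formula).
-/

set_option autoImplicit false
set_option linter.dupNamespace false

noncomputable section

open MeasureTheory Measure Set Filter Topology Function NumberField IsDedekindDomain Matrix Polynomial
open Literature.MeasureTheory.Group
open Literature.NumberTheory.Automorphic Literature.NumberTheory.Automorphic.UnitaryGroup Literature.NumberTheory.Rogawski1990
open Summit.HodgeConjecture.HodgeConjecture.Cruxes.H413.F0P3cStCharTSWeylHypFibre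
open Summit.HodgeConjecture.HodgeConjecture.Cruxes.H413.F0P3cStCharTSWeylHypNormaliser
open Summit.HodgeConjecture.HodgeConjecture.Cruxes.H413.F0P3cStCharTSWeylHypTorsor
open Summit.HodgeConjecture.HodgeConjecture.Cruxes.H413.F0P3cStCharTSWeylHypCM
open Summit.HodgeConjecture.HodgeConjecture.Cruxes.H413.F0P3cStCharTSWeylHypMeasure
open Summit.HodgeConjecture.HodgeConjecture.Cruxes.H413.F0P3cStCharTSWeylHypJacobian
open Summit.HodgeConjecture.HodgeConjecture.Cruxes.H413.F0P3cStCharTSWeylHypTubeSigma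
open Summit.HodgeConjecture.HodgeConjecture.Cruxes.H413.F0P3cStCharTSWeylHypTubeReduction
open scoped ENNReal NNReal MatrixGroups Pointwise

namespace Summit.HodgeConjecture.HodgeConjecture.Cruxes.H413.F0P3cStCharTSWeylHypJacobianDischarge

section CM

variable (L : Type) [Field L] [NumberField L] [IsCMField L] (v : HeightOneSpectrum (𝓞 ↥(maximalRealSubfield L)))

/-! ## §1 The tube over a level coset: `Φ(π(K) × s·T_K) = Ad(K)(s·T_K)` -/

/-- **The tube over `π(K) × (s·T_K)` is the `K`-orbit of the coset `s·T_K`**: `Φ(π(K) × s·T_K) = {k (s τ) k⁻¹ : k ∈ K, τ ∈ T_K}` for `T_K = T ∩ K` read in `T`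
(`Φ(q, t) = x t x⁻¹` on representatives). [cite: HarishChandra1970, Lemma 22] -/
theorem image_Phi_mk_prod_coset
    (Φ : (↥(unitaryGroupOfForm (conjLocal L (IsCMField.complexConj L) v) (cmLocalForm L 3 v)) ⧸ (cmBorelTriple L 3 v).M) × ↥(cmBorelTriple L 3 v).M → ↥(unitaryGroupOfForm (conjLocal L (IsCMField.complexConj L) v) (cmLocalForm L 3 v))) (hΦ : ∀ (x : ↥(unitaryGroupOfForm (conjLocal L (IsCMField.complexConj L) v) (cmLocalForm L 3 v))) (t : ↥(cmBorelTriple L 3 v).M), Φ (QuotientGroup.mk x, t) = x * t * x⁻¹)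
    (K : Subgroup ↥(unitaryGroupOfForm (conjLocal L (IsCMField.complexConj L) v) (cmLocalForm L 3 v))) (s : ↥(cmBorelTriple L 3 v).M) :
    Φ '' ((QuotientGroup.mk '' (K : Set ↥(unitaryGroupOfForm (conjLocal L (IsCMField.complexConj L) v) (cmLocalForm L 3 v)))) ×ˢ (s • ((K.comap (cmBorelTriple L 3 v).M.subtype : Subgroup ↥(cmBorelTriple L 3 v).M) : Set ↥(cmBorelTriple L 3 v).M))) =
      (fun p : ↥(unitaryGroupOfForm (conjLocal L (IsCMField.complexConj L) v) (cmLocalForm L 3 v)) × ↥(cmBorelTriple L 3 v).M => p.1 * (((s * p.2 : ↥(cmBorelTriple L 3 v).M)) : ↥(unitaryGroupOfForm (conjLocal L (IsCMField.complexConj L) v) (cmLocalForm L 3 v))) * p.1⁻¹) '' ((K : Set ↥(unitaryGroupOfForm (conjLocal L (IsCMField.complexConj L) v) (cmLocalForm L 3 v))) ×ˢ ((K.comap (cmBorelTriple L 3 v).M.subtype : Subgroup ↥(cmBorelTriple L 3 v).M) : Set ↥(cmBorelTriple L 3 v).M)) := by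
  ext x
  constructor
  · rintro ⟨⟨q, t⟩, ⟨⟨k, hk, rfl⟩, ht⟩, rfl⟩
    obtain ⟨τ, hτ, rfl⟩ := Set.mem_smul_set.1 ht
    exact ⟨(k, τ), ⟨hk, hτ⟩, by rw [hΦ]; rfl⟩
  · rintro ⟨⟨k, τ⟩, ⟨hk, hτ⟩, rfl⟩
    exact ⟨(QuotientGroup.mk k, s * τ), ⟨⟨k, hk, rfl⟩, Set.smul_mem_smul_set hτ⟩, by rw [hΦ]⟩

/-! ## §2 (J6) THE ASSEMBLY: `hJacLoc` from the orbit-tube and measure identities on a level basis -/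

set_option maxHeartbeats 3200000 in
set_option synthInstance.maxHeartbeats 200000 in
-- same elaboration class as ★ p851645 ∕ ★ (J1): instance terms on the CM local carrier and its quotient
/-- **(J6) «ASSEMBLY → hJacLoc»**: on `G = U(Φ₃)(L⁺_v)` (`v` non-split) with the split torus `T`, let `K : ℕ → Subgroup G` be compact open subgroups, antitone, forming a
neighbourhood basis of `1`, and suppose that at every regular `t₀ ∈ T` there are an open `U ∋ t₀` on which the weight `D` is constant and a threshold `n₀` such that for
every `n ≥ n₀` and every level coset `s·T_n ⊆ U` (`T_n = T ∩ K_n`): `{k (s τ) k⁻¹ : k ∈ K_n, τ ∈ T_n} = s·P` for a measurable `P` with `ν(P) = D(s)·ν(K_n)` (ORBIT-TUBE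
+ MEASURE, the road's (J4)(J5)).  THEN the local tube-Jacobian socket `hJacLoc` of ★ `lintegral_hypSet_eq_of_tubeJacobian_local` holds (its text VERBATIM): hence
«radial measure `= D·tm` on `T^{reg}`» by ★ p851645.  Proof: module docstring. [cite: HarishChandra1970, Lemma 22; Lemma 42] [cite: Rogawski1990, §12.5 p. 182]
[cite: Folland1995, §2.6 Thm. 2.49] -/
theorem tubeJacobianLocal_of_orbitTube
    (hns : ∀ w : PlacesOver L v, IsCMField.complexConj L • w.1 = w.1)
    [MeasurableSpace ↥(unitaryGroupOfForm (conjLocal L (IsCMField.complexConj L) v) (cmLocalForm L 3 v))] [BorelSpace ↥(unitaryGroupOfForm (conjLocal L (IsCMField.complexConj L) v) (cmLocalForm L 3 v))] [LocallyCompactSpace ↥(unitaryGroupOfForm (conjLocal L (IsCMField.complexConj L) v) (cmLocalForm L 3 v))] [SecondCountableTopology ↥(unitaryGroupOfForm (conjLocal L (IsCMField.complexConj L) v) (cmLocalForm L 3 v))] [T2Space ↥(unitaryGroupOfForm (conjLocal L (IsCMField.complexConj L) v) (cmLocalForm L 3 v))]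
    [MeasurableSpace (↥(unitaryGroupOfForm (conjLocal L (IsCMField.complexConj L) v) (cmLocalForm L 3 v)) ⧸ (cmBorelTriple L 3 v).M)] [BorelSpace (↥(unitaryGroupOfForm (conjLocal L (IsCMField.complexConj L) v) (cmLocalForm L 3 v)) ⧸ (cmBorelTriple L 3 v).M)]
    (ν : Measure ↥(unitaryGroupOfForm (conjLocal L (IsCMField.complexConj L) v) (cmLocalForm L 3 v))) [ν.IsHaarMeasure] [ν.IsMulRightInvariant]
    (tm : Measure ↥(cmBorelTriple L 3 v).M) [tm.IsMulLeftInvariant] [IsFiniteMeasureOnCompacts tm] [tm.IsOpenPosMeasure] [tm.IsInvInvariant]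
    (Φ : (↥(unitaryGroupOfForm (conjLocal L (IsCMField.complexConj L) v) (cmLocalForm L 3 v)) ⧸ (cmBorelTriple L 3 v).M) × ↥(cmBorelTriple L 3 v).M → ↥(unitaryGroupOfForm (conjLocal L (IsCMField.complexConj L) v) (cmLocalForm L 3 v))) (hΦ : ∀ (x : ↥(unitaryGroupOfForm (conjLocal L (IsCMField.complexConj L) v) (cmLocalForm L 3 v))) (t : ↥(cmBorelTriple L 3 v).M), Φ (QuotientGroup.mk x, t) = x * t * x⁻¹)
    (w : ↥(unitaryGroupOfForm (conjLocal L (IsCMField.complexConj L) v) (cmLocalForm L 3 v))) (hw : Units.val (w : GL (Fin 3) (LocalRing L v)) = cmLocalForm L 3 v)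
    (D : ↥(cmBorelTriple L 3 v).M → ℝ≥0)
    (K : ℕ → Subgroup ↥(unitaryGroupOfForm (conjLocal L (IsCMField.complexConj L) v) (cmLocalForm L 3 v))) (hKo : ∀ n, IsOpen (K n : Set ↥(unitaryGroupOfForm (conjLocal L (IsCMField.complexConj L) v) (cmLocalForm L 3 v)))) (hKc : ∀ n, IsCompact (K n : Set ↥(unitaryGroupOfForm (conjLocal L (IsCMField.complexConj L) v) (cmLocalForm L 3 v)))) (hanti : Antitone K)
    (hbasis : ∀ W ∈ 𝓝 (1 : ↥(unitaryGroupOfForm (conjLocal L (IsCMField.complexConj L) v) (cmLocalForm L 3 v))), ∃ n, (K n : Set ↥(unitaryGroupOfForm (conjLocal L (IsCMField.complexConj L) v) (cmLocalForm L 3 v))) ⊆ W)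
    (horbit : ∀ t₀ : ↥(cmBorelTriple L 3 v).M, IsRegularElt (((t₀ : ↥(unitaryGroupOfForm (conjLocal L (IsCMField.complexConj L) v) (cmLocalForm L 3 v)))) : GL (Fin 3) (LocalRing L v)) →
      ∃ U : Set ↥(cmBorelTriple L 3 v).M, IsOpen U ∧ t₀ ∈ U ∧ (∀ s ∈ U, D s = D t₀) ∧ ∃ n₀ : ℕ, ∀ n, n₀ ≤ n → ∀ s : ↥(cmBorelTriple L 3 v).M,
        s • ((((K n).comap (cmBorelTriple L 3 v).M.subtype : Subgroup ↥(cmBorelTriple L 3 v).M)) : Set ↥(cmBorelTriple L 3 v).M) ⊆ U →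
          ∃ P : Set ↥(unitaryGroupOfForm (conjLocal L (IsCMField.complexConj L) v) (cmLocalForm L 3 v)), MeasurableSet P ∧
            (fun p : ↥(unitaryGroupOfForm (conjLocal L (IsCMField.complexConj L) v) (cmLocalForm L 3 v)) × ↥(cmBorelTriple L 3 v).M => p.1 * (((s * p.2 : ↥(cmBorelTriple L 3 v).M)) : ↥(unitaryGroupOfForm (conjLocal L (IsCMField.complexConj L) v) (cmLocalForm L 3 v))) * p.1⁻¹) '' (((K n : Set ↥(unitaryGroupOfForm (conjLocal L (IsCMField.complexConj L) v) (cmLocalForm L 3 v)))) ×ˢ ((((K n).comap (cmBorelTriple L 3 v).M.subtype : Subgroup ↥(cmBorelTriple L 3 v).M)) : Set ↥(cmBorelTriple L 3 v).M)) =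
              ((s : ↥(cmBorelTriple L 3 v).M) : ↥(unitaryGroupOfForm (conjLocal L (IsCMField.complexConj L) v) (cmLocalForm L 3 v))) • P ∧
            ν P = (D s : ℝ≥0∞) * ν (K n : Set ↥(unitaryGroupOfForm (conjLocal L (IsCMField.complexConj L) v) (cmLocalForm L 3 v)))) :
    ∀ t₀ : ↥(cmBorelTriple L 3 v).M, IsRegularElt (((t₀ : ↥(unitaryGroupOfForm (conjLocal L (IsCMField.complexConj L) v) (cmLocalForm L 3 v)))) : GL (Fin 3) (LocalRing L v)) →
      ∃ U : Set ↥(cmBorelTriple L 3 v).M, IsOpen U ∧ t₀ ∈ U ∧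
        ∃ A₀ : Set (↥(unitaryGroupOfForm (conjLocal L (IsCMField.complexConj L) v) (cmLocalForm L 3 v)) ⧸ (cmBorelTriple L 3 v).M), MeasurableSet A₀ ∧ (quotientMeasure (cmBorelTriple L 3 v).M tm (isClosed_cmBorelTriple_M L v) ν) A₀ ≠ 0 ∧ (quotientMeasure (cmBorelTriple L 3 v).M tm (isClosed_cmBorelTriple_M L v) ν) A₀ ≠ ∞ ∧
          ∀ V : Set ↥(cmBorelTriple L 3 v).M, MeasurableSet V → V ⊆ U → (∀ t ∈ V, IsRegularElt (((t : ↥(unitaryGroupOfForm (conjLocal L (IsCMField.complexConj L) v) (cmLocalForm L 3 v)))) : GL (Fin 3) (LocalRing L v))) →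
            (∀ t ∈ V, ∀ t' ∈ V, ((t' : ↥(cmBorelTriple L 3 v).M) : ↥(unitaryGroupOfForm (conjLocal L (IsCMField.complexConj L) v) (cmLocalForm L 3 v))) ≠ w * t * w⁻¹) →
              ν (Φ '' (A₀ ×ˢ V)) = (quotientMeasure (cmBorelTriple L 3 v).M tm (isClosed_cmBorelTriple_M L v) ν) A₀ * ∫⁻ t in V, (D t : ℝ≥0∞) ∂tm := by
  classical
  -- the radial measure of ★ (J1) FILE 1 and the carrier facts
  obtain ⟨σ, hσfin, hσsf, hσcar, -, htube⟩ := exists_radialMeasure_tube L v hns ν tm Φ hΦ w hw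
  haveI := hσfin
  have hT := isClosed_cmBorelTriple_M L v
  haveI : SecondCountableTopology ↥(cmBorelTriple L 3 v).M := TopologicalSpace.Subtype.secondCountableTopology _
  -- the torus levels `T_n = T ∩ K_n`: open in `T`, antitone, a basis of `𝓝 1`
  set TK : ℕ → Subgroup ↥(cmBorelTriple L 3 v).M := fun n => (K n).comap (cmBorelTriple L 3 v).M.subtype with hTK
  have hTKcoe : ∀ n, ((TK n : Subgroup ↥(cmBorelTriple L 3 v).M) : Set ↥(cmBorelTriple L 3 v).M) = {t : ↥(cmBorelTriple L 3 v).M | (t : ↥(unitaryGroupOfForm (conjLocal L (IsCMField.complexConj L) v) (cmLocalForm L 3 v))) ∈ (K n : Set ↥(unitaryGroupOfForm (conjLocal L (IsCMField.complexConj L) v) (cmLocalForm L 3 v)))} := fun n => by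
    rw [hTK]; ext t; simp only [Subgroup.coe_comap, Subgroup.coe_subtype, mem_preimage, mem_setOf_eq, SetLike.mem_coe]
  have hTKo : ∀ n, IsOpen ((TK n : Subgroup ↥(cmBorelTriple L 3 v).M) : Set ↥(cmBorelTriple L 3 v).M) := fun n => by
    rw [hTKcoe]; exact (hKo n).preimage continuous_subtype_val
  have hTKanti : Antitone TK := fun a b hab t ht => by
    simp only [hTK, Subgroup.mem_comap] at ht ⊢; exact hanti hab ht
  have hTKbasis : ∀ W ∈ 𝓝 (1 : ↥(cmBorelTriple L 3 v).M), ∃ n, ((TK n : Subgroup ↥(cmBorelTriple L 3 v).M) : Set ↥(cmBorelTriple L 3 v).M) ⊆ W := by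
    intro W hW
    rw [nhds_subtype_eq_comap] at hW
    obtain ⟨W', hW', hsub⟩ := hW
    obtain ⟨n, hn⟩ := hbasis W' (by simpa using hW')
    refine ⟨n, fun t ht => hsub ?_⟩
    rw [hTKcoe] at ht
    exact hn ht
  -- quotient masses of the levels: `μ₀(π K_n) · tm(T_n) = ν(K_n)`, finite and non-zero
  have hmass : ∀ n, (quotientMeasure (cmBorelTriple L 3 v).M tm (isClosed_cmBorelTriple_M L v) ν) (QuotientGroup.mk '' (K n : Set ↥(unitaryGroupOfForm (conjLocal L (IsCMField.complexConj L) v) (cmLocalForm L 3 v)))) * tm {t : ↥(cmBorelTriple L 3 v).M | (t : ↥(unitaryGroupOfForm (conjLocal L (IsCMField.complexConj L) v) (cmLocalForm L 3 v))) ∈ (K n : Set ↥(unitaryGroupOfForm (conjLocal L (IsCMField.complexConj L) v) (cmLocalForm L 3 v)))} = ν (K n : Set ↥(unitaryGroupOfForm (conjLocal L (IsCMField.complexConj L) v) (cmLocalForm L 3 v))) := fun n =>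
    F0P3cStCharTSQuotientMassOpenSubgroup.quotientMeasure_image_mul_measure_eq (cmBorelTriple L 3 v).M hT tm ν (K n) (hKo n)
  have hKpos : ∀ n, ν (K n : Set ↥(unitaryGroupOfForm (conjLocal L (IsCMField.complexConj L) v) (cmLocalForm L 3 v))) ≠ 0 := fun n => ((hKo n).measure_pos ν ⟨1, (K n).one_mem⟩).ne'
  have hKfin : ∀ n, ν (K n : Set ↥(unitaryGroupOfForm (conjLocal L (IsCMField.complexConj L) v) (cmLocalForm L 3 v))) ≠ ∞ := fun n => (hKc n).measure_lt_top.ne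
  have hTKpos : ∀ n, tm {t : ↥(cmBorelTriple L 3 v).M | (t : ↥(unitaryGroupOfForm (conjLocal L (IsCMField.complexConj L) v) (cmLocalForm L 3 v))) ∈ (K n : Set ↥(unitaryGroupOfForm (conjLocal L (IsCMField.complexConj L) v) (cmLocalForm L 3 v)))} ≠ 0 := fun n => by
    rw [← hTKcoe]; exact ((hTKo n).measure_pos tm ⟨1, (TK n).one_mem⟩).ne'
  have hπ0 : ∀ n, (quotientMeasure (cmBorelTriple L 3 v).M tm (isClosed_cmBorelTriple_M L v) ν) (QuotientGroup.mk '' (K n : Set ↥(unitaryGroupOfForm (conjLocal L (IsCMField.complexConj L) v) (cmLocalForm L 3 v)))) ≠ 0 := fun n h => hKpos n (by rw [← hmass n, h, zero_mul])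
  have hπtop : ∀ n, (quotientMeasure (cmBorelTriple L 3 v).M tm (isClosed_cmBorelTriple_M L v) ν) (QuotientGroup.mk '' (K n : Set ↥(unitaryGroupOfForm (conjLocal L (IsCMField.complexConj L) v) (cmLocalForm L 3 v)))) ≠ ∞ := fun n h => by
    have := hmass n
    rw [h, ENNReal.top_mul (hTKpos n)] at this
    exact hKfin n this.symm
  have hTKtop : ∀ n, tm {t : ↥(cmBorelTriple L 3 v).M | (t : ↥(unitaryGroupOfForm (conjLocal L (IsCMField.complexConj L) v) (cmLocalForm L 3 v))) ∈ (K n : Set ↥(unitaryGroupOfForm (conjLocal L (IsCMField.complexConj L) v) (cmLocalForm L 3 v)))} ≠ ∞ := fun n h => by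
    have := hmass n
    rw [h, ENNReal.mul_top (hπ0 n)] at this
    exact hKfin n this.symm
  have hπm : ∀ n, MeasurableSet (QuotientGroup.mk '' (K n : Set ↥(unitaryGroupOfForm (conjLocal L (IsCMField.complexConj L) v) (cmLocalForm L 3 v))) : Set (↥(unitaryGroupOfForm (conjLocal L (IsCMField.complexConj L) v) (cmLocalForm L 3 v)) ⧸ (cmBorelTriple L 3 v).M)) := fun n =>
    ((QuotientGroup.isOpenMap_coe (N := (cmBorelTriple L 3 v).M)) _ (hKo n)).measurableSet
  -- the cover form of ★ (J1) FILE 2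
  refine tubeJacobianLocal_of_cover L v hns ν tm Φ hΦ w hw D fun t₀ ht₀ => ?_
  obtain ⟨U, hUo, ht₀U, hDU, n₀, hcos⟩ := horbit t₀ ht₀
  obtain ⟨U₁, hU₁o, ht₀U₁, hU₁reg, hU₁free⟩ := exists_isOpen_regular_wfree_nhds L v hns w hw t₀ ht₀
  obtain ⟨h𝒞m, hcover⟩ := F0P3cStCharTSOpenCosetCover.cosetFamily_measurable_and_cover TK hTKo hTKanti hTKbasis n₀
  refine ⟨U ∩ U₁, hUo.inter hU₁o, ⟨ht₀U, ht₀U₁⟩, QuotientGroup.mk '' (K n₀ : Set ↥(unitaryGroupOfForm (conjLocal L (IsCMField.complexConj L) v) (cmLocalForm L 3 v))), hπm n₀, hπ0 n₀, hπtop n₀,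
    {C : Set ↥(cmBorelTriple L 3 v).M | ∃ (g : ↥(cmBorelTriple L 3 v).M) (n : ℕ), n₀ ≤ n ∧ C = g • ((TK n : Subgroup ↥(cmBorelTriple L 3 v).M) : Set ↥(cmBorelTriple L 3 v).M)}, h𝒞m,
    fun O hO _ => hcover O hO, ?_⟩
  -- the identity on one coset `C = s • T_n ⊆ U ∩ U₁`, `n ≥ n₀`
  rintro C ⟨s, n, hn, rfl⟩ hCU
  obtain ⟨P, hPm, horb, hνP⟩ := hcos n hn s fun t ht => (hCU ht).1
  have hCm : MeasurableSet (s • ((TK n : Subgroup ↥(cmBorelTriple L 3 v).M) : Set ↥(cmBorelTriple L 3 v).M)) := ((hTKo n).smul s).measurableSet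
  have hCreg : ∀ t ∈ s • ((TK n : Subgroup ↥(cmBorelTriple L 3 v).M) : Set ↥(cmBorelTriple L 3 v).M), IsRegularElt (((t : ↥(unitaryGroupOfForm (conjLocal L (IsCMField.complexConj L) v) (cmLocalForm L 3 v)))) : GL (Fin 3) (LocalRing L v)) := fun t ht => hU₁reg t (hCU ht).2
  have hCfree : ∀ t ∈ s • ((TK n : Subgroup ↥(cmBorelTriple L 3 v).M) : Set ↥(cmBorelTriple L 3 v).M), ∀ t' ∈ s • ((TK n : Subgroup ↥(cmBorelTriple L 3 v).M) : Set ↥(cmBorelTriple L 3 v).M), ((t' : ↥(cmBorelTriple L 3 v).M) : ↥(unitaryGroupOfForm (conjLocal L (IsCMField.complexConj L) v) (cmLocalForm L 3 v))) ≠ w * t * w⁻¹ :=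
    fun t ht t' ht' => hU₁free t (hCU ht).2 t' (hCU ht').2
  -- `σ(C)` from the tube over `π(K_n) × C`
  have h1 := htube _ (hπm n) _ hCm hCreg hCfree
  rw [image_Phi_mk_prod_coset L v Φ hΦ (K n) s, horb, measure_smul, hνP, ← hmass n] at h1
  -- `h1 : D s * (μ₀(πK_n) * tm T_n) = μ₀(πK_n) * σ C`
  have hσC : σ (s • ((TK n : Subgroup ↥(cmBorelTriple L 3 v).M) : Set ↥(cmBorelTriple L 3 v).M)) = (D s : ℝ≥0∞) * tm {t : ↥(cmBorelTriple L 3 v).M | (t : ↥(unitaryGroupOfForm (conjLocal L (IsCMField.complexConj L) v) (cmLocalForm L 3 v))) ∈ (K n : Set ↥(unitaryGroupOfForm (conjLocal L (IsCMField.complexConj L) v) (cmLocalForm L 3 v)))} := by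
    have h2 : (quotientMeasure (cmBorelTriple L 3 v).M tm (isClosed_cmBorelTriple_M L v) ν) (QuotientGroup.mk '' (K n : Set ↥(unitaryGroupOfForm (conjLocal L (IsCMField.complexConj L) v) (cmLocalForm L 3 v)))) * σ (s • ((TK n : Subgroup ↥(cmBorelTriple L 3 v).M) : Set ↥(cmBorelTriple L 3 v).M)) =
        (quotientMeasure (cmBorelTriple L 3 v).M tm (isClosed_cmBorelTriple_M L v) ν) (QuotientGroup.mk '' (K n : Set ↥(unitaryGroupOfForm (conjLocal L (IsCMField.complexConj L) v) (cmLocalForm L 3 v)))) * ((D s : ℝ≥0∞) * tm {t : ↥(cmBorelTriple L 3 v).M | (t : ↥(unitaryGroupOfForm (conjLocal L (IsCMField.complexConj L) v) (cmLocalForm L 3 v))) ∈ (K n : Set ↥(unitaryGroupOfForm (conjLocal L (IsCMField.complexConj L) v) (cmLocalForm L 3 v)))}) := by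
      rw [← h1]; ring
    exact (ENNReal.mul_right_inj (hπ0 n) (hπtop n)).1 h2
  -- `∫⁻_C D dtm = D s · tm C = D s · tm T_n` (`D` constant on `U ⊇ C ∋ s`)
  have hsC : s ∈ s • ((TK n : Subgroup ↥(cmBorelTriple L 3 v).M) : Set ↥(cmBorelTriple L 3 v).M) := F0P3cStCharTSOpenCosetCover.mem_own_smul_coe (TK n) s
  have hDC : ∀ t ∈ s • ((TK n : Subgroup ↥(cmBorelTriple L 3 v).M) : Set ↥(cmBorelTriple L 3 v).M), (D t : ℝ≥0∞) = (D s : ℝ≥0∞) := fun t ht => by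
    rw [hDU t (hCU ht).1, hDU s (hCU hsC).1]
  have hint : ∫⁻ t in s • ((TK n : Subgroup ↥(cmBorelTriple L 3 v).M) : Set ↥(cmBorelTriple L 3 v).M), (D t : ℝ≥0∞) ∂tm = (D s : ℝ≥0∞) * tm {t : ↥(cmBorelTriple L 3 v).M | (t : ↥(unitaryGroupOfForm (conjLocal L (IsCMField.complexConj L) v) (cmLocalForm L 3 v))) ∈ (K n : Set ↥(unitaryGroupOfForm (conjLocal L (IsCMField.complexConj L) v) (cmLocalForm L 3 v)))} := by
    rw [setLIntegral_congr_fun hCm hDC, setLIntegral_const, measure_smul, hTKcoe]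
  rw [htube _ (hπm n₀) _ hCm hCreg hCfree, hσC, hint]

/-! ## §3 The same with the ORBIT-TUBE identity in the road's set-builder shape (`hOrb`∕`hP` of (J6-T) ∕ ★ (J6.5)) -/

/-- The road's set-builder orbit set `{k·s·τ·k⁻¹ : k ∈ K, τ ∈ K ∩ T}` IS the image form of §2. [cite: HarishChandra1970, Lemma 22] -/
theorem setOf_orbit_eq_image_conj (K : Subgroup ↥(unitaryGroupOfForm (conjLocal L (IsCMField.complexConj L) v) (cmLocalForm L 3 v))) (s : ↥(cmBorelTriple L 3 v).M) :
    {x : ↥(unitaryGroupOfForm (conjLocal L (IsCMField.complexConj L) v) (cmLocalForm L 3 v)) | ∃ k ∈ (K : Set ↥(unitaryGroupOfForm (conjLocal L (IsCMField.complexConj L) v) (cmLocalForm L 3 v))), ∃ τ ∈ (K : Set ↥(unitaryGroupOfForm (conjLocal L (IsCMField.complexConj L) v) (cmLocalForm L 3 v))), τ ∈ (cmBorelTriple L 3 v).M ∧ k * (s : ↥(unitaryGroupOfForm (conjLocal L (IsCMField.complexConj L) v) (cmLocalForm L 3 v))) * τ * k⁻¹ = x} =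
      (fun p : ↥(unitaryGroupOfForm (conjLocal L (IsCMField.complexConj L) v) (cmLocalForm L 3 v)) × ↥(cmBorelTriple L 3 v).M => p.1 * (((s * p.2 : ↥(cmBorelTriple L 3 v).M)) : ↥(unitaryGroupOfForm (conjLocal L (IsCMField.complexConj L) v) (cmLocalForm L 3 v))) * p.1⁻¹) '' ((K : Set ↥(unitaryGroupOfForm (conjLocal L (IsCMField.complexConj L) v) (cmLocalForm L 3 v))) ×ˢ ((K.comap (cmBorelTriple L 3 v).M.subtype : Subgroup ↥(cmBorelTriple L 3 v).M) : Set ↥(cmBorelTriple L 3 v).M)) := by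
  ext x
  constructor
  · rintro ⟨k, hk, τ, hτK, hτT, rfl⟩
    refine ⟨(k, ⟨τ, hτT⟩), ⟨hk, ?_⟩, ?_⟩
    · simpa only [SetLike.mem_coe, Subgroup.mem_comap, Subgroup.coe_subtype] using hτK
    · simp only [Subgroup.coe_mul, mul_assoc]
  · rintro ⟨⟨k, τ⟩, ⟨hk, hτ⟩, rfl⟩
    refine ⟨k, hk, (τ : ↥(unitaryGroupOfForm (conjLocal L (IsCMField.complexConj L) v) (cmLocalForm L 3 v))), ?_, τ.2, by simp only [Subgroup.coe_mul, mul_assoc]⟩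
    simpa only [SetLike.mem_coe, Subgroup.mem_comap, Subgroup.coe_subtype] using hτ

set_option maxHeartbeats 3200000 in
set_option synthInstance.maxHeartbeats 200000 in
-- as §2
/-- **(J6) «ASSEMBLY → hJacLoc», road-shape inputs**: as `tubeJacobianLocal_of_orbitTube`, with the per-coset inputs in EXACTLY the shapes the road holder fixed
(2026-09-02T15:26:50Z) for (J6-T) ∕ ★ (J6.5): `hOrb : {x | ∃ k ∈ ↑K, ∃ τ ∈ ↑K, τ ∈ T ∧ k * ↑s * τ * k⁻¹ = x} = (↑s : G) • ↑P` for a subgroup `P` and `hP : ν ↑P = c * ν ↑K` with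
`c = D s`. [cite: HarishChandra1970, Lemma 22; Lemma 42] [cite: Rogawski1990, §12.5 p. 182] [cite: Folland1995, §2.6 Thm. 2.49] -/
theorem tubeJacobianLocal_of_orbitTube'
    (hns : ∀ w : PlacesOver L v, IsCMField.complexConj L • w.1 = w.1)
    [MeasurableSpace ↥(unitaryGroupOfForm (conjLocal L (IsCMField.complexConj L) v) (cmLocalForm L 3 v))] [BorelSpace ↥(unitaryGroupOfForm (conjLocal L (IsCMField.complexConj L) v) (cmLocalForm L 3 v))] [LocallyCompactSpace ↥(unitaryGroupOfForm (conjLocal L (IsCMField.complexConj L) v) (cmLocalForm L 3 v))] [SecondCountableTopology ↥(unitaryGroupOfForm (conjLocal L (IsCMField.complexConj L) v) (cmLocalForm L 3 v))] [T2Space ↥(unitaryGroupOfForm (conjLocal L (IsCMField.complexConj L) v) (cmLocalForm L 3 v))]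
    [MeasurableSpace (↥(unitaryGroupOfForm (conjLocal L (IsCMField.complexConj L) v) (cmLocalForm L 3 v)) ⧸ (cmBorelTriple L 3 v).M)] [BorelSpace (↥(unitaryGroupOfForm (conjLocal L (IsCMField.complexConj L) v) (cmLocalForm L 3 v)) ⧸ (cmBorelTriple L 3 v).M)]
    (ν : Measure ↥(unitaryGroupOfForm (conjLocal L (IsCMField.complexConj L) v) (cmLocalForm L 3 v))) [ν.IsHaarMeasure] [ν.IsMulRightInvariant]
    (tm : Measure ↥(cmBorelTriple L 3 v).M) [tm.IsMulLeftInvariant] [IsFiniteMeasureOnCompacts tm] [tm.IsOpenPosMeasure] [tm.IsInvInvariant]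
    (Φ : (↥(unitaryGroupOfForm (conjLocal L (IsCMField.complexConj L) v) (cmLocalForm L 3 v)) ⧸ (cmBorelTriple L 3 v).M) × ↥(cmBorelTriple L 3 v).M → ↥(unitaryGroupOfForm (conjLocal L (IsCMField.complexConj L) v) (cmLocalForm L 3 v))) (hΦ : ∀ (x : ↥(unitaryGroupOfForm (conjLocal L (IsCMField.complexConj L) v) (cmLocalForm L 3 v))) (t : ↥(cmBorelTriple L 3 v).M), Φ (QuotientGroup.mk x, t) = x * t * x⁻¹)
    (w : ↥(unitaryGroupOfForm (conjLocal L (IsCMField.complexConj L) v) (cmLocalForm L 3 v))) (hw : Units.val (w : GL (Fin 3) (LocalRing L v)) = cmLocalForm L 3 v)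
    (D : ↥(cmBorelTriple L 3 v).M → ℝ≥0)
    (K : ℕ → Subgroup ↥(unitaryGroupOfForm (conjLocal L (IsCMField.complexConj L) v) (cmLocalForm L 3 v))) (hKo : ∀ n, IsOpen (K n : Set ↥(unitaryGroupOfForm (conjLocal L (IsCMField.complexConj L) v) (cmLocalForm L 3 v)))) (hKc : ∀ n, IsCompact (K n : Set ↥(unitaryGroupOfForm (conjLocal L (IsCMField.complexConj L) v) (cmLocalForm L 3 v)))) (hanti : Antitone K)
    (hbasis : ∀ W ∈ 𝓝 (1 : ↥(unitaryGroupOfForm (conjLocal L (IsCMField.complexConj L) v) (cmLocalForm L 3 v))), ∃ n, (K n : Set ↥(unitaryGroupOfForm (conjLocal L (IsCMField.complexConj L) v) (cmLocalForm L 3 v))) ⊆ W)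
    (horbit : ∀ t₀ : ↥(cmBorelTriple L 3 v).M, IsRegularElt (((t₀ : ↥(unitaryGroupOfForm (conjLocal L (IsCMField.complexConj L) v) (cmLocalForm L 3 v)))) : GL (Fin 3) (LocalRing L v)) →
      ∃ U : Set ↥(cmBorelTriple L 3 v).M, IsOpen U ∧ t₀ ∈ U ∧ (∀ s ∈ U, D s = D t₀) ∧ ∃ n₀ : ℕ, ∀ n, n₀ ≤ n → ∀ s : ↥(cmBorelTriple L 3 v).M,
        s • ((((K n).comap (cmBorelTriple L 3 v).M.subtype : Subgroup ↥(cmBorelTriple L 3 v).M)) : Set ↥(cmBorelTriple L 3 v).M) ⊆ U →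
          ∃ P : Subgroup ↥(unitaryGroupOfForm (conjLocal L (IsCMField.complexConj L) v) (cmLocalForm L 3 v)),
            {x : ↥(unitaryGroupOfForm (conjLocal L (IsCMField.complexConj L) v) (cmLocalForm L 3 v)) | ∃ k ∈ (K n : Set ↥(unitaryGroupOfForm (conjLocal L (IsCMField.complexConj L) v) (cmLocalForm L 3 v))), ∃ τ ∈ (K n : Set ↥(unitaryGroupOfForm (conjLocal L (IsCMField.complexConj L) v) (cmLocalForm L 3 v))), τ ∈ (cmBorelTriple L 3 v).M ∧ k * (s : ↥(unitaryGroupOfForm (conjLocal L (IsCMField.complexConj L) v) (cmLocalForm L 3 v))) * τ * k⁻¹ = x} = ((s : ↥(cmBorelTriple L 3 v).M) : ↥(unitaryGroupOfForm (conjLocal L (IsCMField.complexConj L) v) (cmLocalForm L 3 v))) • (P : Set ↥(unitaryGroupOfForm (conjLocal L (IsCMField.complexConj L) v) (cmLocalForm L 3 v))) ∧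
            ν (P : Set ↥(unitaryGroupOfForm (conjLocal L (IsCMField.complexConj L) v) (cmLocalForm L 3 v))) = (D s : ℝ≥0∞) * ν (K n : Set ↥(unitaryGroupOfForm (conjLocal L (IsCMField.complexConj L) v) (cmLocalForm L 3 v)))) :
    ∀ t₀ : ↥(cmBorelTriple L 3 v).M, IsRegularElt (((t₀ : ↥(unitaryGroupOfForm (conjLocal L (IsCMField.complexConj L) v) (cmLocalForm L 3 v)))) : GL (Fin 3) (LocalRing L v)) →
      ∃ U : Set ↥(cmBorelTriple L 3 v).M, IsOpen U ∧ t₀ ∈ U ∧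
        ∃ A₀ : Set (↥(unitaryGroupOfForm (conjLocal L (IsCMField.complexConj L) v) (cmLocalForm L 3 v)) ⧸ (cmBorelTriple L 3 v).M), MeasurableSet A₀ ∧ (quotientMeasure (cmBorelTriple L 3 v).M tm (isClosed_cmBorelTriple_M L v) ν) A₀ ≠ 0 ∧ (quotientMeasure (cmBorelTriple L 3 v).M tm (isClosed_cmBorelTriple_M L v) ν) A₀ ≠ ∞ ∧
          ∀ V : Set ↥(cmBorelTriple L 3 v).M, MeasurableSet V → V ⊆ U → (∀ t ∈ V, IsRegularElt (((t : ↥(unitaryGroupOfForm (conjLocal L (IsCMField.complexConj L) v) (cmLocalForm L 3 v)))) : GL (Fin 3) (LocalRing L v))) →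
            (∀ t ∈ V, ∀ t' ∈ V, ((t' : ↥(cmBorelTriple L 3 v).M) : ↥(unitaryGroupOfForm (conjLocal L (IsCMField.complexConj L) v) (cmLocalForm L 3 v))) ≠ w * t * w⁻¹) →
              ν (Φ '' (A₀ ×ˢ V)) = (quotientMeasure (cmBorelTriple L 3 v).M tm (isClosed_cmBorelTriple_M L v) ν) A₀ * ∫⁻ t in V, (D t : ℝ≥0∞) ∂tm := by
  refine tubeJacobianLocal_of_orbitTube L v hns ν tm Φ hΦ w hw D K hKo hKc hanti hbasis fun t₀ ht₀ => ?_
  obtain ⟨U, hUo, ht₀U, hDU, n₀, hcos⟩ := horbit t₀ ht₀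
  refine ⟨U, hUo, ht₀U, hDU, n₀, fun n hn s hsU => ?_⟩
  obtain ⟨P, horb, hP⟩ := hcos n hn s hsU
  refine ⟨(P : Set ↥(unitaryGroupOfForm (conjLocal L (IsCMField.complexConj L) v) (cmLocalForm L 3 v))), ?_, ?_, hP⟩
  · -- measurability of `↑P`: `↑P = ↑s⁻¹ • (orbit set)`, the orbit set being the continuous image of the compact `↑(K n) ×ˢ ↑T_n`, hence compact and closed
    have hcont : Continuous (fun p : ↥(unitaryGroupOfForm (conjLocal L (IsCMField.complexConj L) v) (cmLocalForm L 3 v)) × ↥(cmBorelTriple L 3 v).M => p.1 * (((s * p.2 : ↥(cmBorelTriple L 3 v).M)) : ↥(unitaryGroupOfForm (conjLocal L (IsCMField.complexConj L) v) (cmLocalForm L 3 v))) * p.1⁻¹) :=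
      (continuous_fst.mul ((continuous_const.mul continuous_subtype_val).comp continuous_snd)).mul continuous_fst.inv
    have hTKc : IsCompact ((((K n).comap (cmBorelTriple L 3 v).M.subtype : Subgroup ↥(cmBorelTriple L 3 v).M)) : Set ↥(cmBorelTriple L 3 v).M) := by
      have hcl : IsClosed ((((K n).comap (cmBorelTriple L 3 v).M.subtype : Subgroup ↥(cmBorelTriple L 3 v).M)) : Set ↥(cmBorelTriple L 3 v).M) := by
        have : ((((K n).comap (cmBorelTriple L 3 v).M.subtype : Subgroup ↥(cmBorelTriple L 3 v).M)) : Set ↥(cmBorelTriple L 3 v).M) = Subtype.val ⁻¹' (K n : Set ↥(unitaryGroupOfForm (conjLocal L (IsCMField.complexConj L) v) (cmLocalForm L 3 v))) := by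
          ext t; simp only [Subgroup.coe_comap, Subgroup.coe_subtype, mem_preimage, SetLike.mem_coe]
        rw [this]
        exact ((hKc n).isClosed).preimage continuous_subtype_val
      exact (isClosed_cmBorelTriple_M L v).isClosedEmbedding_subtypeVal.isCompact_preimage (hKc n) |>.of_isClosed_subset hcl
        (fun t ht => by simpa only [Subgroup.coe_comap, Subgroup.coe_subtype, mem_preimage, SetLike.mem_coe] using ht)
    have himc : IsCompact ((fun p : ↥(unitaryGroupOfForm (conjLocal L (IsCMField.complexConj L) v) (cmLocalForm L 3 v)) × ↥(cmBorelTriple L 3 v).M => p.1 * (((s * p.2 : ↥(cmBorelTriple L 3 v).M)) : ↥(unitaryGroupOfForm (conjLocal L (IsCMField.complexConj L) v) (cmLocalForm L 3 v))) * p.1⁻¹) '' ((K n : Set ↥(unitaryGroupOfForm (conjLocal L (IsCMField.complexConj L) v) (cmLocalForm L 3 v))) ×ˢ ((((K n).comap (cmBorelTriple L 3 v).M.subtype : Subgroup ↥(cmBorelTriple L 3 v).M)) : Set ↥(cmBorelTriple L 3 v).M))) :=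
      ((hKc n).prod hTKc).image hcont
    have hPeq : (P : Set ↥(unitaryGroupOfForm (conjLocal L (IsCMField.complexConj L) v) (cmLocalForm L 3 v))) = ((s : ↥(cmBorelTriple L 3 v).M) : ↥(unitaryGroupOfForm (conjLocal L (IsCMField.complexConj L) v) (cmLocalForm L 3 v)))⁻¹ • ((fun p : ↥(unitaryGroupOfForm (conjLocal L (IsCMField.complexConj L) v) (cmLocalForm L 3 v)) × ↥(cmBorelTriple L 3 v).M => p.1 * (((s * p.2 : ↥(cmBorelTriple L 3 v).M)) : ↥(unitaryGroupOfForm (conjLocal L (IsCMField.complexConj L) v) (cmLocalForm L 3 v))) * p.1⁻¹) '' ((K n : Set ↥(unitaryGroupOfForm (conjLocal L (IsCMField.complexConj L) v) (cmLocalForm L 3 v))) ×ˢ ((((K n).comap (cmBorelTriple L 3 v).M.subtype : Subgroup ↥(cmBorelTriple L 3 v).M)) : Set ↥(cmBorelTriple L 3 v).M))) := by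
      rw [← setOf_orbit_eq_image_conj L v (K n) s, horb, inv_smul_smul]
    rw [hPeq]
    exact (himc.smul _).isClosed.measurableSet
  · rw [← setOf_orbit_eq_image_conj L v (K n) s, horb]

end CM

end Summit.HodgeConjecture.HodgeConjecture.Cruxes.H413.F0P3cStCharTSWeylHypJacobianDischarge

end
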